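import Summits.PneNP.PneNP.Theorems.ConvexRankGatesCaptureTJoinWalks
import Summits.PneNP.PneNP.Theorems.ConvexRankGatesCaptureTJoinDet
import Mathlib.Algebra.MvPolynomial.Degrees
import HarnessLib

/-!
# Crux `Capture` (stmt-PneNP-2659) — the T-JOIN door is ONE GRANK gate: functoriality, degrees,
# alternation and block structure of the pairing matrix

Bookkeeping for `pairConnected_isGRankGate`:

* `bigN_map`, `schurM_map` — the transfer and pairing matrices commute with ring homomorphisms applied
  to the weights (used to specialise edge variables and the generic skew source weights);
* `totalDegree_bigN_le_one` — with edge weights `X i` and constant source weights every entry of the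
  transfer matrix is affine, so it is a generic symbolic matrix `K₀ + Σ Xᵢ Kᵢ`;
* `schurM_transpose` — with SKEW source weights (`c j i = −c i j`) the pairing matrix is alternating
  (`(1 + A)^L` is symmetric);
* `schurM_blockTriangular` — if the unselected edge weights vanish, the pairing matrix is block diagonal
  with respect to any labelling of the terminals that is constant on connectivity classes of the selected
  subgraph.

[folklore]
-/

namespace Summit.PneNP.PneNP.Theorems.Capture.TJoin

set_option linter.dupNamespace false -- `Summit.PneNP.PneNP.…`: summit = sub-problem (D-0017)

open Matrix Finset

variable {V : Type} [Fintype V] [DecidableEq V] {n k : ℕ} {R S : Type} [CommRing R] [CommRing S]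

/-! ### Functoriality in the weights -/

omit [Fintype V] in
/-- `adjW` commutes with ring homomorphisms of the weights. [folklore] -/
theorem adjW_map (p q : Fin n → V) (w : Fin n → R) (φ : R →+* S) :
    (adjW p q w).map φ = adjW p q (fun i => φ (w i)) := by
  ext u u'
  simp only [Matrix.map_apply, adjW_apply, map_sum]
  exact Finset.sum_congr rfl fun i _ => by split_ifs <;> simp

/-- Powers of the lazy walk matrix commute with ring homomorphisms of the weights. [folklore] -/
theorem one_add_adjW_pow_map (p q : Fin n → V) (w : Fin n → R) (φ : R →+* S) (m : ℕ) :
    ((1 + adjW p q w) ^ m).map φ = (1 + adjW p q (fun i => φ (w i))) ^ m := by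
  rw [Matrix.map_pow, Matrix.map_add _ (map_add φ), adjW_map,
    Matrix.map_one _ (map_zero φ) (map_one φ)]
  -- `Matrix.map_add` produces `(1 : Matrix).map φ + …`; both sides now agree

/-- **The pairing matrix commutes with ring homomorphisms of the weights.** [folklore] -/
theorem schurM_map (p q : Fin n → V) (τ : Fin k → V) (w : Fin n → R) (c : Fin k → Fin k → R) (L : ℕ)
    (φ : R →+* S) :
    (schurM p q τ w c L).map φ = schurM p q τ (fun i => φ (w i)) (fun i j => φ (c i j)) L := by
  ext j i
  rw [Matrix.map_apply, schurM_apply, schurM_apply, map_mul, ← one_add_adjW_pow_map, Matrix.map_apply]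

/-- Entries of the layered transfer matrix. [folklore] -/
theorem layerMat_apply (p q : Fin n → V) (w : Fin n → R) (L k' : ℕ) (u u' : V) (a b : Fin (L + 1))
    (j j' : Fin k') :
    layerMat p q w L k' ((u, a), j) ((u', b), j') =
      if j = j' ∧ (b : ℕ) = a + 1 then (1 + adjW p q w) u u' else 0 := by
  rw [← pow_one (layerMat p q w L k'), layerMat_pow_apply, pow_one]

/-- The layered transfer matrix commutes with ring homomorphisms of the weights. [folklore] -/
theorem layerMat_map (p q : Fin n → V) (w : Fin n → R) (L k' : ℕ) (φ : R →+* S) :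
    (layerMat p q w L k').map φ = layerMat p q (fun i => φ (w i)) L k' := by
  ext ⟨⟨u, a⟩, j⟩ ⟨⟨u', b⟩, j'⟩
  rw [Matrix.map_apply, layerMat_apply, layerMat_apply]
  split_ifs
  · have h := congrFun (congrFun (one_add_adjW_pow_map p q w φ 1) u) u'
    simpa only [pow_one, Matrix.map_apply] using h
  · exact map_zero φ

/-- **The transfer matrix commutes with ring homomorphisms of the weights.** [folklore] -/
theorem bigN_map (p q : Fin n → V) (τ : Fin k → V) (w : Fin n → R) (c : Fin k → Fin k → R) (L : ℕ)
    (φ : R →+* S) :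
    (bigN p q τ w c L).map φ = bigN p q τ (fun i => φ (w i)) (fun i j => φ (c i j)) L := by
  rw [bigN, bigN, Matrix.fromBlocks_map, Matrix.map_sub _ (map_sub φ), layerMat_map,
    Matrix.map_one _ (map_zero φ) (map_one φ), Matrix.map_zero _ (map_zero φ)]
  congr 1
  · ext r i
    simp only [Matrix.map_apply, srcMat_apply]
    split_ifs
    · rfl
    · exact map_zero φ
  · ext j r
    simp only [Matrix.map_apply, snkMat_apply]
    split_ifs
    · exact map_one φ
    · exact map_zero φ

/-! ### Degrees: the transfer matrix with variable edge weights is affine -/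

section Degrees

variable {F : Type} [Field F]

omit [Fintype V] in
/-- Entries of `adjW p q X` have total degree `≤ 1`. [folklore] -/
theorem totalDegree_adjW_X_le (p q : Fin n → V) (u u' : V) :
    (adjW p q (fun i => (MvPolynomial.X i : MvPolynomial (Fin n) F)) u u').totalDegree ≤ 1 := by
  rw [adjW_apply]
  refine (MvPolynomial.totalDegree_finsetSum _ _).trans (Finset.sup_le fun i _ => ?_)
  split_ifs
  · exact (MvPolynomial.totalDegree_X (R := F) i).le
  · simp

omit [Fintype V] in
/-- Entries of `1 + adjW p q X` have total degree `≤ 1`. [folklore] -/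
theorem totalDegree_one_add_adjW_X_le (p q : Fin n → V) (u u' : V) :
    ((1 + adjW p q (fun i => (MvPolynomial.X i : MvPolynomial (Fin n) F))) u u').totalDegree ≤ 1 := by
  rw [Matrix.add_apply, Matrix.one_apply]
  refine (MvPolynomial.totalDegree_add _ _).trans (max_le ?_ (totalDegree_adjW_X_le p q u u'))
  split_ifs <;> simp

/-- **Every entry of the transfer matrix with edge weights `X i` and constant source weights is affine.**
[folklore] -/
theorem totalDegree_bigN_le_one (p q : Fin n → V) (τ : Fin k → V) (c : Fin k → Fin k → F) (L : ℕ) :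
    ∀ r r', (bigN p q τ (fun i => (MvPolynomial.X i : MvPolynomial (Fin n) F))
      (fun i j => MvPolynomial.C (c i j)) L r r').totalDegree ≤ 1 := by
  rintro (⟨⟨u, a⟩, j⟩ | j) (⟨⟨u', b⟩, j'⟩ | i)
  · -- `(1 - layerMat) r r'`
    rw [bigN, Matrix.fromBlocks_apply₁₁, Matrix.sub_apply, layerMat_apply]
    refine (MvPolynomial.totalDegree_sub _ _).trans (max_le ?_ ?_)
    · rw [Matrix.one_apply]; split_ifs <;> simp
    · split_ifs
      · exact totalDegree_one_add_adjW_X_le p q u u'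
      · simp
  · rw [bigN, Matrix.fromBlocks_apply₁₂, srcMat_apply]
    split_ifs <;> simp
  · rw [bigN, Matrix.fromBlocks_apply₂₁, snkMat_apply]
    split_ifs <;> simp
  · rw [bigN, Matrix.fromBlocks_apply₂₂, Matrix.zero_apply]
    simp

end Degrees

/-! ### Alternation and block structure of the pairing matrix -/

/-- `(1 + A)^L` is symmetric. [folklore] -/
theorem one_add_adjW_pow_apply_comm (p q : Fin n → V) (w : Fin n → R) (L : ℕ) (u u' : V) :
    ((1 + adjW p q w) ^ L) u u' = ((1 + adjW p q w) ^ L) u' u := by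
  have h : ((1 + adjW p q w) ^ L)ᵀ = (1 + adjW p q w) ^ L := by
    rw [Matrix.transpose_pow, Matrix.transpose_add, Matrix.transpose_one, adjW_transpose]
  conv_lhs => rw [← h, Matrix.transpose_apply]

/-- **With skew source weights the pairing matrix is alternating.** [folklore] -/
theorem schurM_transpose : ∀ {V : Type} [Fintype V] [DecidableEq V] {n k : ℕ} {R : Type} [CommRing R]
    (p q : Fin n → V) (τ : Fin k → V) (w : Fin n → R) (c : Fin k → Fin k → R),
    (∀ i j, c j i = -c i j) → ∀ L : ℕ, (schurM p q τ w c L)ᵀ = -schurM p q τ w c L := by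
  intro V _ _ n k R _ p q τ w c hc L
  ext j i
  rw [Matrix.transpose_apply, Matrix.neg_apply, schurM_apply, schurM_apply, hc i j,
    one_add_adjW_pow_apply_comm p q w L (τ i) (τ j), neg_mul]

/-- **Block structure**: if the unselected edge weights vanish and the labelling `lab` of the terminals
separates terminals in different connectivity classes of the selected subgraph, the pairing matrix is
block triangular (indeed block diagonal) with respect to `lab`. [folklore] -/
theorem schurM_blockTriangular (p q : Fin n → V) (τ : Fin k → V) (v : Fin n → Bool) (w : Fin n → R)
    (hw : ∀ i, v i = false → w i = 0) (c : Fin k → Fin k → R) (L : ℕ) {α : Type*} [LinearOrder α]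
    (lab : Fin k → α)
    (hlab : ∀ j i, lab j ≠ lab i →
      ¬ (SimpleGraph.fromRel fun a b => ∃ i, v i = true ∧ p i = a ∧ q i = b).Reachable (τ j) (τ i)) :
    (schurM p q τ w c L).BlockTriangular lab := by
  intro j i hlt
  rw [schurM_apply]
  have hW : ((1 + adjW p q w) ^ L) (τ j) (τ i) = 0 := by
    by_contra hne
    exact hlab j i hlt.ne' (pow_apply_ne_zero_reachable p q v w hw L (τ j) (τ i) hne)
  rw [hW, mul_zero]

/-- The diagonal blocks of an alternating matrix are alternating. [folklore] -/
theorem toSquareBlock_transpose_of_transpose_eq_neg {m β : Type*} (M : Matrix m m R)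
    (hM : Mᵀ = -M) (b : m → β) (a : β) :
    (M.toSquareBlock b a)ᵀ = -(M.toSquareBlock b a) := by
  ext ⟨i, hi⟩ ⟨j, hj⟩
  have h := congrFun (congrFun hM i) j
  rw [Matrix.transpose_apply, Matrix.neg_apply] at h
  rw [Matrix.transpose_apply, Matrix.neg_apply, Matrix.toSquareBlock_def, Matrix.of_apply, Matrix.of_apply]
  exact h

end Summit.PneNP.PneNP.Theorems.Capture.TJoin
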